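import Summits.CriticalPhenomena.PercolationContinuityZ3.Theses.PercNearOneGluing
import Literature.Probability.Percolation.PercolationEvents
import HarnessLib.Audit
import Literature.Probability.LatticeModels.ProdBernoulliIndependence
import Summits.CriticalPhenomena.PercolationContinuityZ3.Theorems.PercNearOneGluingNearOneGluingVariants2415

/-! TTRL-lite variant V2442 of stmt-CriticalPhenomena-4574

(`stub_shorteningStep` of line `kn_shortening_induction`, move `specialise+small_case`:
`n := 4` and `A.card = 3`).  On four vertices a three-element relay set `A` missing `v` is the
complement of `{v}`, so the glued partner `x ≠ v` is itself a relay.  The step then follows from the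
already-landed two-relay case V2415 (`stub_shorteningStep_var2415`, Kozma–Nitzan's shortening step for
`A.card ≤ 2`, arXiv:2401.12397 Conjecture 6) applied to the sub-relay-set `{a₀, x}`: the minimiser
`a₀` of `P_w(· ↔ b)` over `A` is a fortiori a minimiser over `{a₀, x} ⊆ A`, and under the glued
weights `w[s(v,x) ↦ 1]` the pair `s(v,x)` is open almost surely
(`prodBernoulli_real_setOf_notMem`), so `μ₁(v ↔ A) ≤ μ₁(v ↔ {a₀, x})` (indeed both equal `1`).
The displayed induction hypothesis is only passed through.  No new definitions, no named facts. -/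

namespace Summit.CriticalPhenomena.PercolationContinuityZ3.Theorems

open MeasureTheory Set Literature.Probability.LatticeModels Literature.Probability.Percolation
open scoped Classical BigOperators

/-- TTRL-lite variant V2442 of `stub_shorteningStep` (stmt-CriticalPhenomena-4574): Kozma–Nitzan's
shortening step (Conjecture 6 of arXiv:2401.12397, against the minimiser `a₀` of the uncontracted
graph) on `Fin 4` with `A.card = 3`.  Since `v ∉ A` and `|A| = 3 = 4 - 1`, the glued partner `x`
lies in `A`; the claim reduces to the two-relay case `stub_shorteningStep_var2415` for `{a₀, x}`,
because `s(v,x)` is almost surely open under `prodBernoulli (w[s(v,x) ↦ 1])` and hence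
`μ₁(v ↔ A) ≤ μ₁(v ↔ {a₀, x})`. -/
theorem stub_shorteningStep_var2442 : ∀ (w : Sym2 (Fin 4) → unitInterval) (A : Finset (Fin 4)) (b v x a₀ : Fin 4), A.card = 3 → v ∉ A → v ≠ x → w s(v, x) = 0 → a₀ ∈ A → (∀ a ∈ A, (prodBernoulli w).real (openConn a₀ b) ≤ (prodBernoulli w).real (openConn a b)) → (∀ w' : Sym2 (Fin 4) → unitInterval, (∀ e, w e = 0 → w' e = 0) → ∀ (A' : Finset (Fin 4)) (o' b' : Fin 4) (t : ℝ), (∀ a ∈ A', t ≤ (prodBernoulli w').real (openConn a b')) → (prodBernoulli w').real (⋃ a ∈ A', openConn o' a) * t ≤ (prodBernoulli w').real (openConn o' b')) → (prodBernoulli (Function.update w s(v, x) 1)).real (⋃ a ∈ A, openConn v a) * (prodBernoulli (Function.update w s(v, x) 1)).real (openConn a₀ b) ≤ (prodBernoulli (Function.update w s(v, x) 1)).real (openConn v b) := by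
  intro w A b v x a₀ hcard hvA hvx hw0 ha₀ hmin hIH
  -- `x ∈ A`: otherwise `insert v (insert x A)` would have five elements in `Fin 4`
  have hxA : x ∈ A := by
    by_contra hxA
    have hv' : v ∉ insert x A := by
      simp only [Finset.mem_insert, not_or]
      exact ⟨hvx, hvA⟩
    have hle : (insert v (insert x A)).card ≤ 4 := by
      calc (insert v (insert x A)).card ≤ Fintype.card (Fin 4) := Finset.card_le_univ _
        _ = 4 := Fintype.card_fin 4
    rw [Finset.card_insert_of_notMem hv', Finset.card_insert_of_notMem hxA, hcard] at hle
    omega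
  -- the two-relay case for the sub-relay-set `{a₀, x}`
  have hvA₂ : v ∉ ({a₀, x} : Finset (Fin 4)) := by
    simp only [Finset.mem_insert, Finset.mem_singleton, not_or]
    exact ⟨fun h => hvA (h ▸ ha₀), hvx⟩
  have hcard₂ : ({a₀, x} : Finset (Fin 4)).card ≤ 2 :=
    (Finset.card_insert_le a₀ {x}).trans (by rw [Finset.card_singleton])
  have hmin₂ : ∀ a ∈ ({a₀, x} : Finset (Fin 4)),
      (prodBernoulli w).real (openConn a₀ b) ≤ (prodBernoulli w).real (openConn a b) := by
    intro a ha
    simp only [Finset.mem_insert, Finset.mem_singleton] at ha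
    rcases ha with ha | ha
    · rw [ha]
    · rw [ha]; exact hmin x hxA
  have h2415 := stub_shorteningStep_var2415 4 w ({a₀, x} : Finset (Fin 4)) b v x a₀ hcard₂ hvA₂
    hvx hw0 (Finset.mem_insert_self a₀ {x}) hmin₂ hIH
  -- the glued pair is closed with probability `0`
  have hclosed : (prodBernoulli (Function.update w s(v, x) 1)).real
      {ω : BondConfig (Fin 4) | s(v, x) ∉ ω} = 0 := by
    rw [prodBernoulli_real_setOf_notMem, Function.update_self]
    simp
  -- hence `μ₁(v ↔ A) ≤ μ₁(v ↔ {a₀, x})` (an open `s(v,x)` joins `v` to the relay `x`)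
  have hYY : (prodBernoulli (Function.update w s(v, x) 1)).real (⋃ a ∈ A, openConn v a) ≤
      (prodBernoulli (Function.update w s(v, x) 1)).real
        (⋃ a ∈ ({a₀, x} : Finset (Fin 4)), openConn v a) := by
    have hsub : (⋃ a ∈ A, openConn v a : Set (BondConfig (Fin 4))) ⊆
        (⋃ a ∈ ({a₀, x} : Finset (Fin 4)), openConn v a) ∪
          {ω : BondConfig (Fin 4) | s(v, x) ∉ ω} := by
      intro ω _
      by_cases h : s(v, x) ∈ ω
      · left
        have hadj : (openGraph ω).Adj v x := (openGraph_adj ω v x).2 ⟨h, hvx⟩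
        simp only [Set.mem_iUnion, exists_prop]
        exact ⟨x, by simp, hadj.reachable⟩
      · exact Or.inr h
    calc (prodBernoulli (Function.update w s(v, x) 1)).real (⋃ a ∈ A, openConn v a)
        ≤ (prodBernoulli (Function.update w s(v, x) 1)).real
            ((⋃ a ∈ ({a₀, x} : Finset (Fin 4)), openConn v a) ∪
              {ω : BondConfig (Fin 4) | s(v, x) ∉ ω}) := measureReal_mono hsub
      _ ≤ (prodBernoulli (Function.update w s(v, x) 1)).real
            (⋃ a ∈ ({a₀, x} : Finset (Fin 4)), openConn v a) +
            (prodBernoulli (Function.update w s(v, x) 1)).real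
              {ω : BondConfig (Fin 4) | s(v, x) ∉ ω} := measureReal_union_le _ _
      _ = (prodBernoulli (Function.update w s(v, x) 1)).real
            (⋃ a ∈ ({a₀, x} : Finset (Fin 4)), openConn v a) := by rw [hclosed, add_zero]
  calc (prodBernoulli (Function.update w s(v, x) 1)).real (⋃ a ∈ A, openConn v a) *
        (prodBernoulli (Function.update w s(v, x) 1)).real (openConn a₀ b)
      ≤ (prodBernoulli (Function.update w s(v, x) 1)).real
            (⋃ a ∈ ({a₀, x} : Finset (Fin 4)), openConn v a) *
          (prodBernoulli (Function.update w s(v, x) 1)).real (openConn a₀ b) :=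
        mul_le_mul_of_nonneg_right hYY measureReal_nonneg
    _ ≤ (prodBernoulli (Function.update w s(v, x) 1)).real (openConn v b) := h2415

end Summit.CriticalPhenomena.PercolationContinuityZ3.Theorems
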